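import Mathlib
import Summits.ValiantsHypothesis.ValiantsHypothesis.Theorems.FifoMatchingNNDivisionHardArcFaces
import HarnessLib

/-!
# Route FifoMatching — crux `NNDivisionHard` (stmt-ValiantsHypothesis-21181): faces avoiding a STABBED arc set are hard —
# cofactors generic for an arc set crossing one even boundary are not certificates

`…ArcFaces.lean` treated ONE crossing arc.  The same split survives for ANY set `I` of arcs all CROSSING one even boundary
`2b` (`e.1 < 2b ≤ e.2` for every `e ∈ I` — a STABBED arc set, arbitrary size and lengths): block-stable matchings use no
crossing arc, so `top_{𝟙_L}(NN_{b+c}^{¬I}) = ι_L(NN_b) · ι_R(NN_c)` and `L₊(NN_b), L₊(NN_c) ≤ L₊(NN_{b+c}^{¬I}) + 3`,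
`max (b, c) ≥ n/2`.  With `…ArcElimination.complexity_avoidingFace_le_of_top_monomial`:

* `topComponent_lWeight_stabbedFace`, `complexity_nn_left_le_stabbedFace`, `complexity_nn_right_le_stabbedFace`;
* ★★ `stabbedFace_qp_hard` — **for every `c`, eventually in `n`: for every `b` and every arc set `I` stabbed by `2b`
  (`b ≤ n`; any size, any lengths), `L₊(NN_n^{¬I}) ≤ 16 ((2n+1)(L+2))² ⇒ 2^((log₂ n + c)^c) < L`;**
* ★★ `stabbedGeneric_not_certificate_qp` — **for every `c`, eventually in `n`: a cofactor `h` whose outer face `top_{𝟙_{I^c}} h`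
  is a single monomial for SOME stabbed arc set `I` satisfies `2^((log₂ n + c)^c) < L₊(NN_n · h) + L₊(h)`** — e.g. power sums
  `(Σ_M c_M x^M)^D` led by a nest-free `M₀` such that every other `M` owns an arc outside `M₀` crossing one common boundary.

Together with `…ShortArcGeneric.lean` (any SHORT arc set) and `…ArcGenericTier.lean` (any single arc) this is the third
decided shape of separating arc set; arc sets needing two or more boundaries are NOT treated (a block recursion would be
needed).  HONEST FRAMING: a genericity tier for ONE candidate family; stmt-21181 stays OPEN; nothing here bears on `NNNotVP`
or on VP ≠ VNP (NOT proved).  No definitions, no named facts.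
References: Hrubeš–Yehudayoff 2021 §6 Problem 2 [HrubesYehudayoff2021]; Chen–Deng–Du–Stanley–Yan 2007 §1
[ChenDengDuStanleyYan2007]; Bürgisser 2000 Rem. 2.7 [Burgisser2000].
-/

noncomputable section

-- Sub = Summit single-conjunct layout: the duplicated namespace component is mandated by the tree.
set_option linter.dupNamespace false
set_option autoImplicit false

namespace Summit.ValiantsHypothesis.ValiantsHypothesis.Theorems.FifoMatching.NNDivisionHard.StabbedFaces

open Finset MvPolynomial Literature.Computability.AlgebraicComplexity
open Summit.ValiantsHypothesis.ValiantsHypothesis.Theorems.ZeroOneTransfer.Negative (topComponent)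
open Summit.ValiantsHypothesis.ValiantsHypothesis.Theorems.FifoMatching.NNDivisionHard.StackPowersQueue
  (blockEmb blockEmb_injective topComponent_sum_arcMonomial shiftMatching shiftMatching_mem)
open Summit.ValiantsHypothesis.ValiantsHypothesis.Theorems.FifoMatching.NNDivisionHard.LinearTransport
  (complexity_le_of_vars_outside)
open Summit.ValiantsHypothesis.ValiantsHypothesis.Theorems.FifoMatching.NNDivisionHard.SplitFace
  (lWeight blockEmbR two_mul_le blockEmbR_injective topComponent_lWeight weight_le weight_eq_iff glue2 glue2_mem
    glue2_stable support_rename_blockEmbR_outside support_rename_blockEmb_outside)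
open Summit.ValiantsHypothesis.ValiantsHypothesis.Theorems.FifoMatching.NNDivisionHard.ArcElimination
  (complexity_avoidingFace_le_of_top_monomial)
open Summit.ValiantsHypothesis.ValiantsHypothesis.Theorems.FifoMatching.NNDivisionHard.BinomialPowers
  (absorb_arith absorb_exp)
open Summit.ValiantsHypothesis.ValiantsHypothesis.Theorems.FifoMatching.NNDivisionHard.ArcFaces
  (polylog_lt_rpow_half_eventually)
open scoped NNReal BigOperators

/-! ### §1 The split face inside a stabbed-set-avoiding family -/

section Split

variable {b c : ℕ}

/-- **Split face of the `I`-avoiding family for a STABBED arc set** (`e.1 < 2b ≤ e.2` for all `e ∈ I`):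
`top_{𝟙_L}(NN_{b+c}^{¬I}) = ι_L(NN_b) · ι_R(NN_c)`. [cite: ChenDengDuStanleyYan2007, §1] -/
theorem topComponent_lWeight_stabbedFace (I : Finset (Fin (2 * (b + c)) × Fin (2 * (b + c))))
    (hI : ∀ e ∈ I, (e.1 : ℕ) < 2 * b ∧ 2 * b ≤ (e.2 : ℕ)) :
    topComponent (lWeight b c) (∑ M ∈ (nestFreeMatchings (2 * (b + c))).filter
        (fun M => ∀ j ∈ openers M, (j, M j) ∉ I), arcMonomial ℝ≥0 M) =
      rename (blockEmb (two_mul_le b c)) (nestFreeMatchingPoly b ℝ≥0) *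
        rename (blockEmbR b c) (nestFreeMatchingPoly c ℝ≥0) := by
  classical
  set S := (nestFreeMatchings (2 * (b + c))).filter (fun M => ∀ j ∈ openers M, (j, M j) ∉ I) with hS
  have hSsub : S ⊆ perfectMatchings (2 * (b + c)) :=
    (Finset.filter_subset _ _).trans nestFreeMatchings_subset_perfectMatchings
  -- a block-stable matching avoids every crossing arc
  have hstable_avoids : ∀ M : Fin (2 * (b + c)) → Fin (2 * (b + c)),
      (∀ i : Fin (2 * (b + c)), (i : ℕ) < 2 * b → (M i : ℕ) < 2 * b) → ∀ j ∈ openers M, (j, M j) ∉ I := by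
    intro M hst j _ hjI
    obtain ⟨h1, h2⟩ := hI _ hjI
    simp only at h1 h2
    have := hst j h1
    omega
  have hG := glue2_mem (shiftMatching_mem b) (shiftMatching_mem c)
  have hGS : glue2 (shiftMatching b) (shiftMatching c) ∈ S :=
    Finset.mem_filter.2 ⟨hG, hstable_avoids _ (glue2_stable _ _)⟩
  have h1 : topComponent (lWeight b c) (∑ M ∈ S, arcMonomial ℝ≥0 M) =
      ∑ M ∈ S.filter (fun M => Finsupp.weight (lWeight b c) (arcExponent M) = b), arcMonomial ℝ≥0 M :=
    topComponent_sum_arcMonomial (lWeight b c) hSsub (W := b) (fun M hM => weight_le (hSsub hM))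
      ⟨_, hGS, (weight_eq_iff (nestFreeMatchings_subset_perfectMatchings hG)).2 (glue2_stable _ _)⟩
  have h2 : topComponent (lWeight b c) (nestFreeMatchingPoly (b + c) ℝ≥0) =
      ∑ M ∈ (nestFreeMatchings (2 * (b + c))).filter (fun M => Finsupp.weight (lWeight b c) (arcExponent M) = b),
        arcMonomial ℝ≥0 M := by
    rw [nestFreeMatchingPoly_eq_sum_arcMonomial]
    exact topComponent_sum_arcMonomial (lWeight b c) nestFreeMatchings_subset_perfectMatchings (W := b)
      (fun M hM => weight_le (nestFreeMatchings_subset_perfectMatchings hM))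
      ⟨_, hG, (weight_eq_iff (nestFreeMatchings_subset_perfectMatchings hG)).2 (glue2_stable _ _)⟩
  have h3 : S.filter (fun M => Finsupp.weight (lWeight b c) (arcExponent M) = b) =
      (nestFreeMatchings (2 * (b + c))).filter (fun M => Finsupp.weight (lWeight b c) (arcExponent M) = b) := by
    ext M
    simp only [hS, Finset.mem_filter]
    constructor
    · rintro ⟨⟨hM, -⟩, hW⟩; exact ⟨hM, hW⟩
    · rintro ⟨hM, hW⟩
      exact ⟨⟨hM, hstable_avoids M ((weight_eq_iff (nestFreeMatchings_subset_perfectMatchings hM)).1 hW)⟩, hW⟩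
  rw [h1, h3, ← h2, topComponent_lWeight]

/-- `L₊(NN_b) ≤ L₊(NN_{b+c}^{¬I}) + 3` for a stabbed arc set `I`. [cite: Burgisser2000, Rem. 2.7] -/
theorem complexity_nn_left_le_stabbedFace (I : Finset (Fin (2 * (b + c)) × Fin (2 * (b + c))))
    (hI : ∀ e ∈ I, (e.1 : ℕ) < 2 * b ∧ 2 * b ≤ (e.2 : ℕ)) :
    complexity (nestFreeMatchingPoly b ℝ≥0) ≤ complexity (∑ M ∈ (nestFreeMatchings (2 * (b + c))).filter
        (fun M => ∀ j ∈ openers M, (j, M j) ∉ I), arcMonomial ℝ≥0 M) + 3 := by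
  have hR0 : rename (blockEmbR b c) (nestFreeMatchingPoly c ℝ≥0) ≠ 0 := fun h0 =>
    MonomialCofactor.nn_ne_zero c (rename_injective _ blockEmbR_injective (by rw [h0, map_zero]))
  have H := complexity_le_of_vars_outside (blockEmb_injective (two_mul_le b c)) (lWeight b c)
    (topComponent_lWeight_stabbedFace I hI) hR0 (support_rename_blockEmbR_outside _)
    (h := (1 : MvPolynomial (Fin (2 * (b + c)) × Fin (2 * (b + c))) ℝ≥0)) one_ne_zero
    (fun v hv => by simp [vars_one] at hv)
  rw [mul_one] at H
  omega

/-- `L₊(NN_c) ≤ L₊(NN_{b+c}^{¬I}) + 3` for a stabbed arc set `I`. [cite: Burgisser2000, Rem. 2.7] -/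
theorem complexity_nn_right_le_stabbedFace (I : Finset (Fin (2 * (b + c)) × Fin (2 * (b + c))))
    (hI : ∀ e ∈ I, (e.1 : ℕ) < 2 * b ∧ 2 * b ≤ (e.2 : ℕ)) :
    complexity (nestFreeMatchingPoly c ℝ≥0) ≤ complexity (∑ M ∈ (nestFreeMatchings (2 * (b + c))).filter
        (fun M => ∀ j ∈ openers M, (j, M j) ∉ I), arcMonomial ℝ≥0 M) + 3 := by
  have hL0 : rename (blockEmb (two_mul_le b c)) (nestFreeMatchingPoly b ℝ≥0) ≠ 0 := fun h0 =>
    MonomialCofactor.nn_ne_zero b (rename_injective _ (blockEmb_injective (two_mul_le b c)) (by rw [h0, map_zero]))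
  have H := complexity_le_of_vars_outside blockEmbR_injective (lWeight b c)
    ((topComponent_lWeight_stabbedFace I hI).trans (mul_comm _ _)) hL0 (support_rename_blockEmb_outside _)
    (h := (1 : MvPolynomial (Fin (2 * (b + c)) × Fin (2 * (b + c))) ℝ≥0)) one_ne_zero
    (fun v hv => by simp [vars_one] at hv)
  rw [mul_one] at H
  omega

end Split

/-! ### §2 Stabbed faces are hard; stabbed-generic cofactors are not certificates -/

variable {n : ℕ}

/-- ★★ **STABBED FACES, stretched-exponential form.**  Eventually in `n`: for every `1 ≤ b`, `b < n` and every arc set `I`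
with `e.1 < 2b ≤ e.2` for all `e ∈ I` there is a half `m` (`n ≤ 2m`) with `2^{m^{1/6}} ≤ L₊(NN_n^{¬I}) + 3`.
[cite: HrubesYehudayoff2021, §6 Problem 2] -/
theorem stabbedFace_exp_lower_bound : ∃ n₀ : ℕ, ∀ n : ℕ, n₀ ≤ n → ∀ b : ℕ, b ≤ n →
    ∀ I : Finset (Fin (2 * n) × Fin (2 * n)), (∀ e ∈ I, (e.1 : ℕ) < 2 * b ∧ 2 * b ≤ (e.2 : ℕ)) →
    ∃ m : ℕ, n ≤ 2 * m ∧ (2 : ℝ) ^ ((m : ℝ) ^ ((1 : ℝ) / 6)) ≤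
      ((complexity (∑ M ∈ (nestFreeMatchings (2 * n)).filter (fun M => ∀ j ∈ openers M, (j, M j) ∉ I),
        arcMonomial ℝ≥0 M) + 3 : ℕ) : ℝ) := by
  obtain ⟨n₀, hn₀⟩ := NNMonotoneExpBound.exp_lower_bound
  refine ⟨2 * n₀, fun n hn b hbn I hI => ?_⟩
  obtain ⟨c, hc⟩ := Nat.exists_eq_add_of_le hbn
  subst hc
  by_cases hbc : c ≤ b
  · refine ⟨b, by omega, ?_⟩
    exact (hn₀ b (by omega)).trans (by exact_mod_cast complexity_nn_left_le_stabbedFace I hI)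
  · refine ⟨c, by omega, ?_⟩
    exact (hn₀ c (by omega)).trans (by exact_mod_cast complexity_nn_right_le_stabbedFace I hI)

/-- ★★ **STABBED FACES ARE HARD (quasi-polynomial currency).**  For every `c`, eventually in `n`: for every `b ≤ n`, every
arc set `I` stabbed by `2b` and every `L`, `L₊(NN_n^{¬I}) ≤ 16 ((2n+1)(L+2))² ⇒ 2^((log₂ n + c)^c) < L`.
[cite: HrubesYehudayoff2021, §6 Problem 2] -/
theorem stabbedFace_qp_hard (c : ℕ) : ∃ n₀ : ℕ, ∀ n : ℕ, n₀ ≤ n → ∀ b : ℕ, b ≤ n →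
    ∀ I : Finset (Fin (2 * n) × Fin (2 * n)), (∀ e ∈ I, (e.1 : ℕ) < 2 * b ∧ 2 * b ≤ (e.2 : ℕ)) → ∀ L : ℕ,
    complexity (∑ M ∈ (nestFreeMatchings (2 * n)).filter (fun M => ∀ j ∈ openers M, (j, M j) ∉ I),
      arcMonomial ℝ≥0 M) ≤ 16 * ((2 * n + 1) * (L + 2)) ^ 2 →
    2 ^ ((Nat.log 2 n + c) ^ c) < L := by
  set K : ℕ := c + 14 with hK
  obtain ⟨n₂, hn₂⟩ := stabbedFace_exp_lower_bound
  obtain ⟨n₃, hn₃⟩ := polylog_lt_rpow_half_eventually (K + 2)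
  refine ⟨max n₂ n₃, fun n hn b hbn I hI L hface => ?_⟩
  have hn2 : n₂ ≤ n := le_trans (le_max_left _ _) hn
  have hn3 : n₃ ≤ n := le_trans (le_max_right _ _) hn
  set F := complexity (∑ M ∈ (nestFreeMatchings (2 * n)).filter (fun M => ∀ j ∈ openers M, (j, M j) ∉ I),
      arcMonomial ℝ≥0 M) with hF
  by_contra hle
  push Not at hle
  have e1 := absorb_arith n c L hle
  have e3 : 2 ^ (2 * (Nat.log 2 n + c) ^ c + 2 * Nat.log 2 n + 13) ≤ 2 ^ ((Nat.log 2 n + K) ^ K) :=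
    Nat.pow_le_pow_right (by norm_num) (absorb_exp (Nat.log 2 n) c)
  have h7 : 16 * ((2 * n + 1) * (L + 2)) ^ 2 + 1 ≤ 2 ^ ((Nat.log 2 n + K) ^ K) := e1.trans e3
  have hp : (Nat.log 2 n + K) ^ K + 2 ≤ (Nat.log 2 n + (K + 2)) ^ (K + 2) := by
    have h1 : (Nat.log 2 n + K) ^ K ≤ (Nat.log 2 n + (K + 2)) ^ K := Nat.pow_le_pow_left (by omega) K
    have h2 : 1 ≤ (Nat.log 2 n + (K + 2)) ^ K := Nat.one_le_pow _ _ (by omega)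
    have h3 : 2 ^ 2 ≤ (Nat.log 2 n + (K + 2)) ^ 2 := Nat.pow_le_pow_left (by omega) 2
    have h4 : 3 * (Nat.log 2 n + (K + 2)) ^ K ≤ (Nat.log 2 n + (K + 2)) ^ K * (Nat.log 2 n + (K + 2)) ^ 2 := by
      rw [mul_comm]
      exact Nat.mul_le_mul_left _ (by norm_num at h3; omega)
    calc (Nat.log 2 n + K) ^ K + 2 ≤ 3 * (Nat.log 2 n + (K + 2)) ^ K := by omega
      _ ≤ (Nat.log 2 n + (K + 2)) ^ K * (Nat.log 2 n + (K + 2)) ^ 2 := h4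
      _ = (Nat.log 2 n + (K + 2)) ^ (K + 2) := by rw [← pow_add]
  have h8 : 16 * ((2 * n + 1) * (L + 2)) ^ 2 + 3 ≤ 2 ^ ((Nat.log 2 n + (K + 2)) ^ (K + 2)) := by
    calc 16 * ((2 * n + 1) * (L + 2)) ^ 2 + 3 ≤ 4 * (16 * ((2 * n + 1) * (L + 2)) ^ 2 + 1) := by omega
      _ ≤ 4 * 2 ^ ((Nat.log 2 n + K) ^ K) := Nat.mul_le_mul_left 4 h7
      _ = 2 ^ ((Nat.log 2 n + K) ^ K + 2) := by rw [pow_add]; ring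
      _ ≤ 2 ^ ((Nat.log 2 n + (K + 2)) ^ (K + 2)) := Nat.pow_le_pow_right (by norm_num) hp
  obtain ⟨m, hm, hexp⟩ := hn₂ n hn2 b hbn I hI
  have h2 := hn₃ n hn3 m hm
  have h3 : (2 : ℝ) ^ ((((Nat.log 2 n + (K + 2)) ^ (K + 2) : ℕ) : ℝ)) < (2 : ℝ) ^ ((m : ℝ) ^ ((1 : ℝ) / 6)) :=
    Real.rpow_lt_rpow_of_exponent_lt (by norm_num) h2
  have h4 : ((2 ^ ((Nat.log 2 n + (K + 2)) ^ (K + 2)) : ℕ) : ℝ) < ((F + 3 : ℕ) : ℝ) := by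
    rw [Nat.cast_pow, Nat.cast_ofNat, ← Real.rpow_natCast]
    exact h3.trans_le hexp
  have h5 : 2 ^ ((Nat.log 2 n + (K + 2)) ^ (K + 2)) < F + 3 := by exact_mod_cast h4
  have h9 : F + 3 ≤ 16 * ((2 * n + 1) * (L + 2)) ^ 2 + 3 := Nat.add_le_add_right hface 3
  exact absurd (lt_of_lt_of_le h5 (h9.trans h8)) (lt_irrefl _)

/-- ★★ **STABBED-GENERIC COFACTORS ARE NOT CERTIFICATES.**  For every `c`, eventually in `n`: if for some `b ≤ n` and some
arc set `I` stabbed by `2b` (`e.1 < 2b ≤ e.2` on `I`) and avoided by some nest-free perfect matching the outer face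
`top_{𝟙_{I^c}} h` is a single monomial `a · x^d` (`a ≠ 0`), then `2^((log₂ n + c)^c) < L₊(NN_n · h) + L₊(h)`.
[cite: HrubesYehudayoff2021, §6 Problem 2] [cite: JuknaSeiwertSergeev2022, Thm 1] -/
theorem stabbedGeneric_not_certificate_qp (c : ℕ) : ∃ n₀ : ℕ, ∀ n : ℕ, n₀ ≤ n → ∀ b : ℕ, b ≤ n →
    ∀ I : Finset (Fin (2 * n) × Fin (2 * n)), (∀ e ∈ I, (e.1 : ℕ) < 2 * b ∧ 2 * b ≤ (e.2 : ℕ)) →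
    (∃ M ∈ nestFreeMatchings (2 * n), ∀ j ∈ openers M, (j, M j) ∉ I) →
    ∀ (h : MvPolynomial (Fin (2 * n) × Fin (2 * n)) ℝ≥0) (d : (Fin (2 * n) × Fin (2 * n)) →₀ ℕ) (a : ℝ≥0), a ≠ 0 →
      topComponent (fun v : Fin (2 * n) × Fin (2 * n) => if v ∈ I then 0 else 1) h = monomial d a →
      2 ^ ((Nat.log 2 n + c) ^ c) < complexity (nestFreeMatchingPoly n ℝ≥0 * h) + complexity h := by
  obtain ⟨n₀, hn₀⟩ := stabbedFace_qp_hard c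
  refine ⟨n₀, fun n hn b hbn I hI hIav h d a ha htop => ?_⟩
  have hface := complexity_avoidingFace_le_of_top_monomial I hIav ha htop
  exact lt_of_lt_of_le (hn₀ n hn b hbn I hI _ hface) (Nat.le_add_right _ _)

end Summit.ValiantsHypothesis.ValiantsHypothesis.Theorems.FifoMatching.NNDivisionHard.StabbedFaces

end
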